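import Mathlib.Analysis.SpecialFunctions.Pow.Deriv
import Literature.Analysis.ODE.HeunDerivative
import HarnessLib

/-!
# The F-homotopic "exponent flip" of the general Heun equation (Umetsu's normalisation)

For Heun's equation in the normalisation of [Umetsu2000, §3 (3.1)] used by
`GeneralHeun.IsSolutionOn` — `z(z−1)(z−a_H) f'' + [γ(z−1)(z−a_H) + δz(z−a_H) + εz(z−1)] f' + (αβz+q) f = 0`
with the Fuchs relation `γ+δ+ε = α+β+1` — the local exponents are `{0, 1−γ}` at `0`, `{0, 1−δ}` at
`1`, `{0, 1−ε}` at `a_H` and `{α, β}` at `∞`. Multiplying a solution by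
`z^{γ−1}(1−z)^{δ−1}(a_H−z)^{ε−1}` (the classical F-homotopic transformation applied at all three
finite singular points at once; real variable `z ∈ (0,1)`, `a_H > 1`, principal powers of positive
reals) produces a solution of the Heun equation with the flipped parameters
`(2−γ, 2−δ, 2−ε; 2−α, 2−β)` and accessory parameter
`q♭ = q + (a_H+1)γ + a_Hδ + ε − 2(a_H+1)` (`GeneralHeun.flipQ`; an involution, `flipQ_flipQ`).
This is the elementary symmetry by which Umetsu's derivative transformation
(`GeneralHeun.isSolutionOn_iterate_deriv`, `N = 1 − α`) is applied to the Kerr–de Sitter radial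
equation for POSITIVE spin (Hatsuda's frame has `α = 2s+1`; the flipped frame has `α = 1−2s`), i.e.
the Teukolsky–Starobinsky map `s ↦ −s` ("These transformations are the Teukolsky–Starobinsky
relations", [Umetsu2000, §3]). Everything here is proved (calculus + two rational identities).

References: H. Umetsu, Prog. Theor. Phys. 104 (2000) 743–755 = gr-qc/0005037, §3 [Umetsu2000];
NIST DLMF §31.2 (F-homotopic transformations of Heun's equation).
-/

noncomputable section

open Set Complex

namespace Literature.Analysis.ODE

namespace GeneralHeun

/-! ### The flipped accessory parameter -/

/-- The accessory parameter of the flipped equation: `q♭ = q + (a_H+1)γ + a_Hδ + ε − 2(a_H+1)`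
(Umetsu's sign convention `low = αβz + q`). [cite: Umetsu2000, §3 (3.1)] -/
def flipQ (aH γ δ ε q : ℂ) : ℂ := q + (aH + 1) * γ + aH * δ + ε - 2 * (aH + 1)

/-- The flip is an involution on the accessory parameter. [cite: Umetsu2000, §3 (3.1)] -/
theorem flipQ_flipQ (aH γ δ ε q : ℂ) :
    flipQ aH (2 - γ) (2 - δ) (2 - ε) (flipQ aH γ δ ε q) = q := by
  unfold flipQ; ring

/-- The Fuchs relation is preserved by the flip. [cite: Umetsu2000, §2–§3] -/
theorem fuchs_flip {α β γ δ ε : ℂ} (hF : γ + δ + ε = α + β + 1) :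
    (2 - γ) + (2 - δ) + (2 - ε) = (2 - α) + (2 - β) + 1 := by
  linear_combination -hF

/-! ### The flip weight on `(0,1)` and its logarithmic derivative -/

/-- The flip weight `V(x) = x^{γ−1}(1−x)^{δ−1}(a_H−x)^{ε−1}` for real `x ∈ (0,1)`, `a_H > 1`
(principal complex powers of positive reals). [cite: Umetsu2000, §3 (3.1)] -/
def flipWeight (aH : ℝ) (γ δ ε : ℂ) (x : ℝ) : ℂ :=
  (x : ℂ) ^ (γ - 1) * ((1 - x : ℝ) : ℂ) ^ (δ - 1) * ((aH - x : ℝ) : ℂ) ^ (ε - 1)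

/-- The logarithmic derivative `V'/V = (γ−1)/x + (δ−1)/(x−1) + (ε−1)/(x−a_H)`.
[cite: Umetsu2000, §3 (3.1)] -/
def flipLog (aH : ℝ) (γ δ ε : ℂ) (x : ℝ) : ℂ :=
  (γ - 1) / (x : ℂ) + (δ - 1) / ((x : ℂ) - 1) + (ε - 1) / ((x : ℂ) - aH)

/-- The derivative of `flipLog`: `−(γ−1)/x² − (δ−1)/(x−1)² − (ε−1)/(x−a_H)²`.
[cite: Umetsu2000, §3 (3.1)] -/
def flipLogDeriv (aH : ℝ) (γ δ ε : ℂ) (x : ℝ) : ℂ :=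
  -(γ - 1) / (x : ℂ) ^ 2 - (δ - 1) / ((x : ℂ) - 1) ^ 2 - (ε - 1) / ((x : ℂ) - aH) ^ 2

/-- A principal power of a positive real is non-zero. [folklore] -/
private theorem ofReal_cpow_ne_zero {t : ℝ} (ht : 0 < t) (p : ℂ) : ((t : ℝ) : ℂ) ^ p ≠ 0 := fun h =>
  ht.ne' (by exact_mod_cast ((Complex.cpow_eq_zero_iff _ _).1 h).1)

/-- The flip weight does not vanish on `(0,1)` when `a_H > 1`. [cite: Umetsu2000, §3 (3.1)] -/
theorem flipWeight_ne_zero {aH : ℝ} (haH : 1 < aH) (γ δ ε : ℂ) {x : ℝ} (hx : x ∈ Ioo (0 : ℝ) 1) :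
    flipWeight aH γ δ ε x ≠ 0 := by
  unfold flipWeight
  refine mul_ne_zero (mul_ne_zero (ofReal_cpow_ne_zero hx.1 _) (ofReal_cpow_ne_zero ?_ _))
    (ofReal_cpow_ne_zero ?_ _)
  · linarith [hx.2]
  · linarith [hx.2]

/-- `d/dx x^p = x^p · p/x` for `x > 0` (principal power, real variable). [folklore] -/
private theorem hasDerivAt_ofReal_cpow (p : ℂ) {r : ℝ} (hr : 0 < r) :
    HasDerivAt (fun x : ℝ => (x : ℂ) ^ p) ((r : ℂ) ^ p * (p / (r : ℂ))) r := by
  have hslit : (r : ℂ) ∈ slitPlane := Complex.ofReal_mem_slitPlane.2 hr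
  have hne : (r : ℂ) ≠ 0 := by exact_mod_cast hr.ne'
  have h1 : HasDerivAt (fun z : ℂ => z ^ p) (p * (r : ℂ) ^ (p - 1)) (r : ℂ) := by
    simpa using (hasDerivAt_id (r : ℂ)).cpow_const (c := p) hslit
  refine h1.comp_ofReal.congr_deriv ?_
  rw [Complex.cpow_sub _ _ hne, Complex.cpow_one]
  field_simp

/-- `d/dx (c − x)^p = (c − x)^p · p/(x − c)` for `x < c` (principal power of a positive real).
[folklore] -/
private theorem hasDerivAt_const_sub_cpow (c : ℝ) (p : ℂ) {r : ℝ} (hr : r < c) :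
    HasDerivAt (fun x : ℝ => ((c - x : ℝ) : ℂ) ^ p)
      (((c - r : ℝ) : ℂ) ^ p * (p / ((r : ℂ) - c))) r := by
  have hpos : (0 : ℝ) < c - r := sub_pos.2 hr
  have hslit : ((c : ℂ) - r) ∈ slitPlane := by
    rw [← Complex.ofReal_sub]
    exact Complex.ofReal_mem_slitPlane.2 hpos
  have hne : ((c - r : ℝ) : ℂ) ≠ 0 := by exact_mod_cast hpos.ne'
  have hne' : ((r : ℂ) - c) ≠ 0 := by
    have : ((r - c : ℝ) : ℂ) ≠ 0 := by exact_mod_cast (show r - c ≠ 0 by linarith)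
    simpa using this
  have h1 : HasDerivAt (fun z : ℂ => (c - z) ^ p) (p * ((c : ℂ) - r) ^ (p - 1) * -1) (r : ℂ) :=
    ((hasDerivAt_id (r : ℂ)).const_sub (c : ℂ)).cpow_const hslit
  have hfun : (fun x : ℝ => ((c - x : ℝ) : ℂ) ^ p) = fun y : ℝ => ((c : ℂ) - y) ^ p := by
    funext y
    rw [Complex.ofReal_sub]
  rw [hfun]
  refine h1.comp_ofReal.congr_deriv ?_
  rw [← Complex.ofReal_sub, Complex.cpow_sub _ _ hne, Complex.cpow_one]
  have e : ((c - r : ℝ) : ℂ) = -((r : ℂ) - c) := by push_cast; ring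
  rw [e]
  field_simp

/-- `V' = V · flipLog` on `(0,1)`. [cite: Umetsu2000, §3 (3.1)] -/
theorem hasDerivAt_flipWeight {aH : ℝ} (haH : 1 < aH) (γ δ ε : ℂ) {x : ℝ} (hx : x ∈ Ioo (0 : ℝ) 1) :
    HasDerivAt (flipWeight aH γ δ ε) (flipWeight aH γ δ ε x * flipLog aH γ δ ε x) x := by
  have hA := hasDerivAt_ofReal_cpow (γ - 1) hx.1
  have hB := hasDerivAt_const_sub_cpow 1 (δ - 1) hx.2
  have hC := hasDerivAt_const_sub_cpow aH (ε - 1) (show x < aH by linarith [hx.2])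
  have e : flipWeight aH γ δ ε = fun t : ℝ =>
      (t : ℂ) ^ (γ - 1) * ((1 - t : ℝ) : ℂ) ^ (δ - 1) * ((aH - t : ℝ) : ℂ) ^ (ε - 1) := rfl
  rw [e]
  refine ((hA.mul hB).mul hC).congr_deriv ?_
  simp only [flipLog, Pi.mul_apply]
  push_cast
  ring

/-- `flipLog' = flipLogDeriv` on `(0,1)`. [cite: Umetsu2000, §3 (3.1)] -/
theorem hasDerivAt_flipLog {aH : ℝ} (haH : 1 < aH) (γ δ ε : ℂ) {x : ℝ} (hx : x ∈ Ioo (0 : ℝ) 1) :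
    HasDerivAt (flipLog aH γ δ ε) (flipLogDeriv aH γ δ ε x) x := by
  have hc : HasDerivAt (fun t : ℝ => (t : ℂ)) 1 x := by simpa using (hasDerivAt_id x).ofReal_comp
  have h0 : (x : ℂ) ≠ 0 := by exact_mod_cast hx.1.ne'
  have h1 : (x : ℂ) - 1 ≠ 0 := by
    have : ((x - 1 : ℝ) : ℂ) ≠ 0 := by exact_mod_cast (show x - 1 ≠ 0 by linarith [hx.2])
    simpa using this
  have ha : (x : ℂ) - aH ≠ 0 := by
    have : ((x - aH : ℝ) : ℂ) ≠ 0 := by exact_mod_cast (show x - aH ≠ 0 by linarith [hx.2])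
    simpa using this
  have d0 : HasDerivAt (fun t : ℝ => (γ - 1) / (t : ℂ)) (-((γ - 1) * 1) / (x : ℂ) ^ 2) x :=
    (hc.inv h0 |>.const_mul (γ - 1)).congr_deriv (by field_simp) |>.congr_of_eventuallyEq
      (Filter.Eventually.of_forall fun t => by simp [div_eq_mul_inv])
  have d1 : HasDerivAt (fun t : ℝ => (δ - 1) / ((t : ℂ) - 1)) (-((δ - 1) * 1) / ((x : ℂ) - 1) ^ 2) x :=
    ((hc.sub_const (1 : ℂ)).inv h1 |>.const_mul (δ - 1)).congr_deriv (by field_simp)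
      |>.congr_of_eventuallyEq (Filter.Eventually.of_forall fun t => by simp [div_eq_mul_inv])
  have da : HasDerivAt (fun t : ℝ => (ε - 1) / ((t : ℂ) - aH)) (-((ε - 1) * 1) / ((x : ℂ) - aH) ^ 2) x :=
    ((hc.sub_const (aH : ℂ)).inv ha |>.const_mul (ε - 1)).congr_deriv (by field_simp)
      |>.congr_of_eventuallyEq (Filter.Eventually.of_forall fun t => by simp [div_eq_mul_inv])
  have e : flipLog aH γ δ ε = fun t : ℝ =>
      (γ - 1) / (t : ℂ) + (δ - 1) / ((t : ℂ) - 1) + (ε - 1) / ((t : ℂ) - aH) := rfl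
  rw [e]
  refine ((d0.add d1).add da).congr_deriv ?_
  unfold flipLogDeriv
  ring

/-! ### The two coefficient identities -/

/-- First-order coefficients: `2·lead·ℓ + mid(2−γ,2−δ,2−ε) = mid(γ,δ,ε)`. [cite: Umetsu2000, §3 (3.1)] -/
private theorem mid_flip_identity (aH : ℝ) (γ δ ε : ℂ) {x : ℝ} (h0 : (x : ℂ) ≠ 0)
    (h1 : (x : ℂ) - 1 ≠ 0) (ha : (x : ℂ) - aH ≠ 0) :
    2 * lead (aH : ℂ) x * flipLog aH γ δ ε x + mid (aH : ℂ) (2 - γ) (2 - δ) (2 - ε) x =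
      mid (aH : ℂ) γ δ ε x := by
  unfold lead flipLog mid
  field_simp
  ring

/-- Zeroth-order coefficients (uses the Fuchs relation):
`lead·(ℓ² + ℓ') + mid(2−γ,2−δ,2−ε)·ℓ + ((2−α)(2−β)x + q♭) = αβx + q`. [cite: Umetsu2000, §3 (3.1)] -/
private theorem low_flip_identity (aH : ℝ) {α β γ δ ε : ℂ} (q : ℂ) (hF : γ + δ + ε = α + β + 1)
    {x : ℝ} (h0 : (x : ℂ) ≠ 0) (h1 : (x : ℂ) - 1 ≠ 0) (ha : (x : ℂ) - aH ≠ 0) :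
    lead (aH : ℂ) x * (flipLog aH γ δ ε x ^ 2 + flipLogDeriv aH γ δ ε x) +
        mid (aH : ℂ) (2 - γ) (2 - δ) (2 - ε) x * flipLog aH γ δ ε x +
        low (2 - α) (2 - β) (flipQ aH γ δ ε q) x =
      low α β q x := by
  have hε : ε = α + β + 1 - γ - δ := by linear_combination hF
  unfold lead flipLog flipLogDeriv mid low flipQ
  rw [hε]
  field_simp
  ring

/-! ### The transformation theorem -/

/-- **The exponent flip.** Let `a_H > 1` be real and `U ⊆ (0,1)`. If `f` is a classical solution
on `U` of Umetsu's Heun equation with parameters `(α, β, γ, δ, ε; q)` satisfying the Fuchs relation,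
then `V·f`, `V(x) = x^{γ−1}(1−x)^{δ−1}(a_H−x)^{ε−1}`, is a classical solution on `U` of the Heun
equation with parameters `(2−α, 2−β, 2−γ, 2−δ, 2−ε; q♭)`, `q♭ = flipQ a_H γ δ ε q`. (All local
exponents are reflected: `{0,1−γ} ↦ {γ−1, 0}` at `0`, etc.; in the Kerr–de Sitter radial problem this
exchanges Hatsuda's frame `α = 2s+1` with the frame `α = 1−2s` in which, for `s > 0`, Umetsu's
`N`-th derivative transformation with `N = 2s` applies.) [cite: Umetsu2000, §3 (3.1)–(3.2)] -/
theorem isSolutionOn_flip {aH : ℝ} (haH : 1 < aH) {α β γ δ ε q : ℂ} (hF : γ + δ + ε = α + β + 1)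
    {U : Set ℝ} (hU : U ⊆ Ioo (0 : ℝ) 1) {f : ℝ → ℂ}
    (hf : IsSolutionOn (aH : ℂ) α β γ δ ε q U f) :
    IsSolutionOn (aH : ℂ) (2 - α) (2 - β) (2 - γ) (2 - δ) (2 - ε) (flipQ aH γ δ ε q) U
      (fun x => flipWeight aH γ δ ε x * f x) := by
  obtain ⟨f₁, f₂, hsol⟩ := hf
  set V := flipWeight aH γ δ ε with hV
  set ℓ := flipLog aH γ δ ε with hℓ
  set ℓ' := flipLogDeriv aH γ δ ε with hℓ'
  refine ⟨fun x => V x * (f₁ x + ℓ x * f x),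
    fun x => V x * (f₂ x + 2 * ℓ x * f₁ x + (ℓ x ^ 2 + ℓ' x) * f x), fun x hx => ?_⟩
  have hx01 : x ∈ Ioo (0 : ℝ) 1 := hU hx
  obtain ⟨hd1, hd2, hode⟩ := hsol x hx
  have hVd : HasDerivAt V (V x * ℓ x) x := hasDerivAt_flipWeight haH γ δ ε hx01
  have hℓd : HasDerivAt ℓ (ℓ' x) x := hasDerivAt_flipLog haH γ δ ε hx01
  have h0 : (x : ℂ) ≠ 0 := by exact_mod_cast hx01.1.ne'
  have h1 : (x : ℂ) - 1 ≠ 0 := by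
    have : ((x - 1 : ℝ) : ℂ) ≠ 0 := by exact_mod_cast (show x - 1 ≠ 0 by linarith [hx01.2])
    simpa using this
  have ha : (x : ℂ) - aH ≠ 0 := by
    have : ((x - aH : ℝ) : ℂ) ≠ 0 := by exact_mod_cast (show x - aH ≠ 0 by linarith [hx01.2])
    simpa using this
  refine ⟨?_, ?_, ?_⟩
  · exact (hVd.mul hd1).congr_deriv (by ring)
  · have h := hVd.mul (hd2.add (hℓd.mul hd1))
    refine h.congr_deriv ?_
    simp only [Pi.add_apply, Pi.mul_apply]
    ring
  · have hm := mid_flip_identity aH γ δ ε h0 h1 ha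
    have hl := low_flip_identity aH q hF h0 h1 ha
    -- lead·w₂ + mid♭·w₁ + low♭·w = V·[(2·lead·ℓ + mid♭ − mid) f₁ + (lead(ℓ²+ℓ') + mid♭ℓ + low♭ − low) f]
    --   (using the equation for f), and both brackets vanish.
    have key : lead (aH : ℂ) x * (V x * (f₂ x + 2 * ℓ x * f₁ x + (ℓ x ^ 2 + ℓ' x) * f x)) +
        mid (aH : ℂ) (2 - γ) (2 - δ) (2 - ε) x * (V x * (f₁ x + ℓ x * f x)) +
        low (2 - α) (2 - β) (flipQ aH γ δ ε q) x * (V x * f x) =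
        V x * (lead (aH : ℂ) x * f₂ x + mid (aH : ℂ) γ δ ε x * f₁ x + low α β q x * f x) := by
      rw [← hm, ← hl]
      ring
    rw [key, hode, mul_zero]

/-- The flipped solution is non-trivial where the original one is (the weight does not vanish on
`(0,1)`), and conversely. [cite: Umetsu2000, §3 (3.1)] -/
theorem flip_eq_zero_iff {aH : ℝ} (haH : 1 < aH) (γ δ ε : ℂ) {f : ℝ → ℂ} {x : ℝ}
    (hx : x ∈ Ioo (0 : ℝ) 1) : flipWeight aH γ δ ε x * f x = 0 ↔ f x = 0 := by
  rw [mul_eq_zero, or_iff_right (flipWeight_ne_zero haH γ δ ε hx)]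

end GeneralHeun

end Literature.Analysis.ODE
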